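import Summits.HodgeConjecture.HodgeConjecture.Theorems.F0D6CmCurveBodyK2Leg   -- ★ previous part of the same Lines workfile `D6CmCurveBody` (size-lint split ×6)
import HarnessLib

/-!
# `F0D6CmCurveBodyOpK2` — ★ RE-HOME of `Lines/D6CmCurveBody.lean`, PART 3 of 6 (size-lint split; cut at a top-level declaration boundary).

See PART 1 `Theorems/F0D6CmCurveBodyHonest.lean` for the full re-home header and the original module docstring (verbatim there). Namespaces KEPT
(re-opened below exactly as they stand at the cut, with their `open` lines); code bytes = the workfile՚s, docstrings included; options preamble repeated from PART 1.
HC_CM is proved only modulo the 7 printed citations (2 remaining: hLiu418 = stmt-HodgeConjecture-24832, h413 = stmt-HodgeConjecture-24833) until rung 0 closes; a re-home is count-neutral. -/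

noncomputable section

open scoped TensorProduct NumberField
open NumberField IsDedekindDomain Filter
open Literature.NumberTheory.GaloisRepresentations
open Literature.NumberTheory.Automorphic
open Literature.NumberTheory.Automorphic.Liu2021.AppendixC
open scoped TensorProduct Matrix NumberField Kronecker ComplexOrder
open NumberField NumberField.InfinitePlace IsDedekindDomain
open Summit.HodgeConjecture.CorCM.Model Summit.HodgeConjecture.CorCM.Model.HComp Summit.HodgeConjecture.CorCM.HComp
open Literature.AlgebraicGeometry.Motives (CMType)
open Literature.AlgebraicGeometry.ShimuraVarieties.UnitaryCanonicalModel
open Literature.NumberTheory.Automorphic Literature.NumberTheory.Automorphic.UnitaryGroup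
open Literature.NumberTheory.Automorphic.IdeleClassGroup Literature.NumberTheory.Automorphic.Liu2021 Literature.NumberTheory.Automorphic.Liu2021.AppendixC
open Literature.NumberTheory.GaloisRepresentations Literature.RepresentationTheory.Liu2021 Literature.RepresentationTheory.HarrisKudlaSweet1996
open Literature.AlgebraicGeometry.Liu2021 (IsAdmissibleElement)
open Literature.NumberTheory.Weil1964 Literature.NumberTheory.GelbartRogawski1991 Literature.NumberTheory.GelbartRogawski1991.UnitaryDualPair Literature.NumberTheory.GelbartRogawski1991.UnitaryDualPair.WeilCoinv
open Literature.NumberTheory.GelbartRogawski1991.UnitaryDualPair.LocalSplitting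
open Literature.NumberTheory.Automorphic.Liu2021.Def411WeilCarriersDoubling
open Literature.NumberTheory.Automorphic.Liu2021.Def411WeilCarriers (TW JW JW_eq isSymm_TW isUnit_det_TW Rep Eps epsOf Chi rhoVAtLine)


/-! ## Part K′ — THE SPLIT FORM (A-plan2 (g12) W1 condition 00:21:00Z; REF1 (g11) m03 expected shape): [D.9 on M⋆] (FACT kind) and K2 (stub kind)
as SEPARATE closed shapes, parametrised by the untwisted datum as FUNCTIONS `CM`∕`XM` of the GS record (next run:
`CM := fun F ι₁ Jstar K₀ S h4 isoₛ => sec42DataGS_M S h4 isoₛ`, `XM := … etaleHeckeDatumGS_M S hU7ₛ hLQ h4 isoₛ ℓ`, A-p13 (g18)'s (L2)∕(L3) objects;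
same argument lists as ★ `sec42DataGS` ∕ `etaleHeckeDatumGS`). -/

namespace Summit.HodgeConjecture.CorCM.Lines.A3Liu418

section SplitK2

variable (CM : ∀ (F : Type) [Field F] [NumberField F] [IsCMField F] (ι₁ : F →+* ℂ) (Jstar : Matrix (Fin 2) (Fin 2) F)
      (K₀ : C5.OpenCompactSubgroup ↥(finAdelic ↥(maximalRealSubfield F) F (IsCMField.complexConj F) 2 Jstar))
      (S : RecordSystemGS F Jstar ι₁ K₀) (h4 : 4 ≤ Module.finrank ℚ F) (isoₛ : ℕ → Prop),
      Sec42Data (Literature.NumberTheory.Automorphic.Liu2021.AppendixC.honestP5GSM F Jstar K₀ S.M) isoₛ)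
  (XM : ∀ (F : Type) [Field F] [NumberField F] [IsCMField F] (ι₁ : F →+* ℂ) (Jstar : Matrix (Fin 2) (Fin 2) F)
      (K₀ : C5.OpenCompactSubgroup ↥(finAdelic ↥(maximalRealSubfield F) F (IsCMField.complexConj F) 2 Jstar))
      (S : RecordSystemGS F Jstar ι₁ K₀) (hU7ₛ : S.HeckeTranslateDefinedOver) (hLQ : S.IsLevelQuotient)
      (h4 : 4 ≤ Module.finrank ℚ F) (isoₛ : ℕ → Prop) (ℓ : ℕ) [Fact ℓ.Prime],
      (CM F ι₁ Jstar K₀ S h4 isoₛ).EtaleHeckeDatum ℓ)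

/-- **`CorD9OnMShape CM XM`** — [Liu2021, Cor. D.9] ON `M⋆` VERBATIM (same place, standard anchor `⟨w′, rfl⟩`, arithmetic-inverse form, `∀ K` before
`∃ S₀`) for the untwisted datum `CM …` ∕ `XM …` and the registered carrier `ω⋆` — the FACT kind of s201 (3)(i), binder prefix = the registry's. -/
def CorD9OnMShape : Prop :=
  ∀ (F : CMField) [IsGalois ℚ F] (ι₁ : F →+* ℂ)
    (μ : Literature.NumberTheory.Automorphic.IdeleClassGroup (F : Type) →ₜ* Circle)
    (hμ : IdeleClassGroup.IsConjugateSymplectic (F : Type) μ)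
    (_hw : IdeleClassGroup.HasWeight (F : Type) μ 1)
    (ℓ : ℕ) [Fact ℓ.Prime] (ι' : ℂ ≃+* AlgebraicClosure ℚ_[ℓ])
    (Jstar : Matrix (Fin 2) (Fin 2) (F : Type)) (t : (F : Type)) (ht : t ≠ 0) (_hτt : 0 < (ι₁ t).re) (_hτt' : (ι₁ t).im = 0)
    (gstar : GL (Fin 2) (F : Type))
    (dJ : Fin 2 → (F : Type)) (hdJ : ∀ i, IsCMField.complexConj (F : Type) (dJ i) = dJ i) (hdJ0 : ∀ i, dJ i ≠ 0)
    (hg : formCongr ((IsCMField.complexConj (F : Type) : (F : Type) ≃ₐ[↥(maximalRealSubfield (F : Type))] (F : Type)) :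
        (F : Type) →+* (F : Type)) gstar (t • Jstar) = Matrix.diagonal dJ)
    (_hsig : (∃ Tstar : GL (Fin 2) ℂ,
        formCongr (starRingEnd ℂ) Tstar ((Matrix.diagonal dJ).map ι₁) = Matrix.diagonal ![(1 : ℂ), -1]) ∧
      ∀ τ' : (F : Type) →+* ℂ, InfinitePlace.mk τ' ≠ InfinitePlace.mk ι₁ → ((Matrix.diagonal dJ).map τ').PosDef)
    (K₀ : C5.OpenCompactSubgroup ↥(finAdelic ↥(maximalRealSubfield (F : Type)) (F : Type) (IsCMField.complexConj (F : Type)) 2 Jstar))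
    (S : RecordSystemGS (F : Type) Jstar ι₁ K₀) (hU7ₛ : S.HeckeTranslateDefinedOver) (hLQ : S.IsLevelQuotient)
    (h4 : 4 ≤ Module.finrank ℚ (F : Type)) (isoₛ : ℕ → Prop)
    (r : Rep ↥(maximalRealSubfield (F : Type)) (imagUnitSq F))
    (ε : Eps ↥(maximalRealSubfield (F : Type)) (imagUnitSq F))
    (_hadm : ∃ e : (F : Type), IsAdmissibleElement (F : Type) hμ.cmType.1 e ∧
      epsOf ↥(maximalRealSubfield (F : Type)) (imagUnitSq F) (F : Type) (2 * imagUnit (F : Type))⁻¹ (-e) = ε)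
    (χ : Chi ↥(maximalRealSubfield (F : Type)) (F : Type) (IsCMField.complexConj (F : Type))),
    ∀ (hJ : (Jstar.map (IsCMField.complexConj (F : Type)))ᵀ = Jstar) (hJu : IsUnit Jstar) (K : C5.SmallLevel K₀),
        ∃ S₀ : Set (HeightOneSpectrum (𝓞 (F : Type))), S₀.Finite ∧
      ∀ w : HeightOneSpectrum (𝓞 (F : Type)), w ∉ S₀ → ∀ hw : (IsCMField.complexConj (F : Type)) • w ≠ w,
        (UnitaryGroup.isUnit_placeForm Jstar hJu w).unit ∈ glInt 2 (w.adicCompletion (F : Type)) →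
            UnitaryGroup.IsHyperspecialAt ↥(maximalRealSubfield (F : Type)) (F : Type) (IsCMField.complexConj (F : Type)) 2 Jstar K.1.1 (w.under (𝓞 ↥(maximalRealSubfield (F : Type)))) →
            ∀ 𝔓 ∈ w.primesAbove, ∀ σ : Field.absoluteGaloisGroup (F : Type), IsArithFrobAt (𝓞 (F : Type)) σ 𝔓 →
            ∀ g ∈ (XM (F : Type) ι₁ Jstar K₀ S hU7ₛ hLQ h4 isoₛ ℓ).omegaHom ι'
                ((rhoVAtLine ↥(maximalRealSubfield (F : Type)) (F : Type) (IsCMField.complexConj (F : Type)) 2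
          (finProdFinEquiv : Fin 2 × Fin 1 ≃ Fin (2 * 1)) (Matrix.diagonal dJ)
          (complexConj_imagUnit F) (imagUnit_ne_zero F) (imagUnit_mul_self F) (realDiagonal_isSymm F dJ hdJ)
          (isUnit_det_realDiagonal F dJ hdJ hdJ0) (realDiagonal_map F dJ hdJ).symm
          (hsChiGS F finProdFinEquiv dJ hdJ hdJ0
            (toHeckeCharacter (F : Type) (galConj (IsCMField.complexConj (F : Type)) μ))
            (isUnitary_toHeckeCharacter (F : Type) (galConj (IsCMField.complexConj (F : Type)) μ))
            ((isOscillatorChar_toHeckeCharacter_iff (galConj (IsCMField.complexConj (F : Type)) μ)).mpr hμ.galConj))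
          (r.toFun ε) χ).comp
          (finAdelicCongr ↥(maximalRealSubfield (F : Type)) (F : Type) (IsCMField.complexConj (F : Type)) gstar ht hg).symm.toMonoidHom), ∀ x ∈ Representation.fixedPoints
                ((rhoVAtLine ↥(maximalRealSubfield (F : Type)) (F : Type) (IsCMField.complexConj (F : Type)) 2
          (finProdFinEquiv : Fin 2 × Fin 1 ≃ Fin (2 * 1)) (Matrix.diagonal dJ)
          (complexConj_imagUnit F) (imagUnit_ne_zero F) (imagUnit_mul_self F) (realDiagonal_isSymm F dJ hdJ)
          (isUnit_det_realDiagonal F dJ hdJ hdJ0) (realDiagonal_map F dJ hdJ).symm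
          (hsChiGS F finProdFinEquiv dJ hdJ hdJ0
            (toHeckeCharacter (F : Type) (galConj (IsCMField.complexConj (F : Type)) μ))
            (isUnitary_toHeckeCharacter (F : Type) (galConj (IsCMField.complexConj (F : Type)) μ))
            ((isOscillatorChar_toHeckeCharacter_iff (galConj (IsCMField.complexConj (F : Type)) μ)).mpr hμ.galConj))
          (r.toFun ε) χ).comp
          (finAdelicCongr ↥(maximalRealSubfield (F : Type)) (F : Type) (IsCMField.complexConj (F : Type)) gstar ht hg).symm.toMonoidHom) K.1.1,
              (Ideal.absNorm w.asIdeal : AlgebraicClosure ℚ_[ℓ]) •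
                  ((CM (F : Type) ι₁ Jstar K₀ S h4 isoₛ).towerRep ℓ σ).baseChange (AlgebraicClosure ℚ_[ℓ])
                    (((CM (F : Type) ι₁ Jstar K₀ S h4 isoₛ).towerRep ℓ σ).baseChange (AlgebraicClosure ℚ_[ℓ])
                      (g (UnitaryGroup.heckeTAt ↥(maximalRealSubfield (F : Type)) (F : Type) (IsCMField.complexConj (F : Type)) 2 Jstar
                    ((rhoVAtLine ↥(maximalRealSubfield (F : Type)) (F : Type) (IsCMField.complexConj (F : Type)) 2
          (finProdFinEquiv : Fin 2 × Fin 1 ≃ Fin (2 * 1)) (Matrix.diagonal dJ)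
          (complexConj_imagUnit F) (imagUnit_ne_zero F) (imagUnit_mul_self F) (realDiagonal_isSymm F dJ hdJ)
          (isUnit_det_realDiagonal F dJ hdJ hdJ0) (realDiagonal_map F dJ hdJ).symm
          (hsChiGS F finProdFinEquiv dJ hdJ hdJ0
            (toHeckeCharacter (F : Type) (galConj (IsCMField.complexConj (F : Type)) μ))
            (isUnitary_toHeckeCharacter (F : Type) (galConj (IsCMField.complexConj (F : Type)) μ))
            ((isOscillatorChar_toHeckeCharacter_iff (galConj (IsCMField.complexConj (F : Type)) μ)).mpr hμ.galConj))
          (r.toFun ε) χ).comp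
          (finAdelicCongr ↥(maximalRealSubfield (F : Type)) (F : Type) (IsCMField.complexConj (F : Type)) gstar ht hg).symm.toMonoidHom)
                    K.1.1 (⟨w, rfl⟩ : UnitaryGroup.PlacesOver (F : Type) (w.under (𝓞 ↥(maximalRealSubfield (F : Type)))))
                  (IsCMField.complexConj_ne_one (F : Type)) hJ hw (UnitaryGroup.isUnit_placeForm Jstar hJu w) (HeckeCharacter.uniformizer (F : Type) w) 2 x))) -
                ((CM (F : Type) ι₁ Jstar K₀ S h4 isoₛ).towerRep ℓ σ).baseChange (AlgebraicClosure ℚ_[ℓ])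
                  (g (UnitaryGroup.heckeTAt ↥(maximalRealSubfield (F : Type)) (F : Type) (IsCMField.complexConj (F : Type)) 2 Jstar
                    ((rhoVAtLine ↥(maximalRealSubfield (F : Type)) (F : Type) (IsCMField.complexConj (F : Type)) 2
          (finProdFinEquiv : Fin 2 × Fin 1 ≃ Fin (2 * 1)) (Matrix.diagonal dJ)
          (complexConj_imagUnit F) (imagUnit_ne_zero F) (imagUnit_mul_self F) (realDiagonal_isSymm F dJ hdJ)
          (isUnit_det_realDiagonal F dJ hdJ hdJ0) (realDiagonal_map F dJ hdJ).symm
          (hsChiGS F finProdFinEquiv dJ hdJ hdJ0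
            (toHeckeCharacter (F : Type) (galConj (IsCMField.complexConj (F : Type)) μ))
            (isUnitary_toHeckeCharacter (F : Type) (galConj (IsCMField.complexConj (F : Type)) μ))
            ((isOscillatorChar_toHeckeCharacter_iff (galConj (IsCMField.complexConj (F : Type)) μ)).mpr hμ.galConj))
          (r.toFun ε) χ).comp
          (finAdelicCongr ↥(maximalRealSubfield (F : Type)) (F : Type) (IsCMField.complexConj (F : Type)) gstar ht hg).symm.toMonoidHom)
                    K.1.1 (⟨w, rfl⟩ : UnitaryGroup.PlacesOver (F : Type) (w.under (𝓞 ↥(maximalRealSubfield (F : Type)))))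
                  (IsCMField.complexConj_ne_one (F : Type)) hJ hw (UnitaryGroup.isUnit_placeForm Jstar hJu w) (HeckeCharacter.uniformizer (F : Type) w) 1 x)) +
                g x = 0

/-- **`K2Shape CM XM`** — the K2 transport (s201 (3)(ii), `stub_K2` kind; A-p13 (g18)'s lemma discharges it): for every GS record, a linear
equivalence of étale H¹ towers `X⋆ → M⋆`, Hecke-compatible, carrying every arithmetic Frobenius at `𝔓 ∣ w` (split `w`) to one at some `𝔓′ ∣ c • w`. -/
def K2Shape : Prop :=
  ∀ (F : CMField) [IsGalois ℚ F] (ι₁ : F →+* ℂ) (ℓ : ℕ) [Fact ℓ.Prime] (Jstar : Matrix (Fin 2) (Fin 2) (F : Type))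
    (K₀ : C5.OpenCompactSubgroup ↥(finAdelic ↥(maximalRealSubfield (F : Type)) (F : Type) (IsCMField.complexConj (F : Type)) 2 Jstar))
    (S : RecordSystemGS (F : Type) Jstar ι₁ K₀) (hU7ₛ : S.HeckeTranslateDefinedOver) (hLQ : S.IsLevelQuotient)
    (h4 : 4 ≤ Module.finrank ℚ (F : Type)) (isoₛ : ℕ → Prop),
    ∃ ψ : (sec42DataGS S h4 isoₛ).etaleH1Tower ℓ ≃ₗ[ℚ_[ℓ]] (CM (F : Type) ι₁ Jstar K₀ S h4 isoₛ).etaleH1Tower ℓ,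
      (∀ (g : ↥(finAdelic ↥(maximalRealSubfield (F : Type)) (F : Type) (IsCMField.complexConj (F : Type)) 2 Jstar))
        (y : (sec42DataGS S h4 isoₛ).etaleH1Tower ℓ),
          ψ ((etaleHeckeDatumGS S hU7ₛ hLQ h4 isoₛ ℓ).rhoEt g y) = (XM (F : Type) ι₁ Jstar K₀ S hU7ₛ hLQ h4 isoₛ ℓ).rhoEt g (ψ y)) ∧
      (∀ w : HeightOneSpectrum (𝓞 (F : Type)), (IsCMField.complexConj (F : Type)) • w ≠ w →
        ∀ 𝔓 ∈ w.primesAbove, ∀ σ : Field.absoluteGaloisGroup (F : Type), IsArithFrobAt (𝓞 (F : Type)) σ 𝔓 →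
          ∃ σ' : Field.absoluteGaloisGroup (F : Type),
            (∃ 𝔓' ∈ ((IsCMField.complexConj (F : Type)) • w).primesAbove, IsArithFrobAt (𝓞 (F : Type)) σ' 𝔓') ∧
            ∀ y, ψ ((sec42DataGS S h4 isoₛ).towerRep ℓ σ y) = (CM (F : Type) ι₁ Jstar K₀ S h4 isoₛ).towerRep ℓ σ' (ψ y))

/-- **`S3ShapeM` ⇐ [D.9 on M⋆] + K2**, split form (one application of `s3M_clause_of_d9M_of_K2` per label and level; `Exists.elim`
term mode, default budget; A-p06 (g15) fix 3). -/
theorem s3ShapeM_of_D9M_K2 (hD9M : CorD9OnMShape CM XM) (hK2 : K2Shape CM XM) : S3ShapeM := by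
  intro F _ ι₁ μ hμ hw ℓ _ ι' Jstar t ht hτt hτt' gstar dJ hdJ hdJ0 hg hsig K₀ S hU7ₛ hLQ h4 isoₛ r ε hadm χ hJ hJu K
  exact (hK2 F ι₁ ℓ Jstar K₀ S hU7ₛ hLQ h4 isoₛ).elim fun ψ hψ =>
    s3M_clause_of_d9M_of_K2 F ℓ ι' Jstar K₀ S hU7ₛ hLQ h4 isoₛ hJ hJu _ (CM (F : Type) ι₁ Jstar K₀ S h4 isoₛ)
      (XM (F : Type) ι₁ Jstar K₀ S hU7ₛ hLQ h4 isoₛ ℓ) ψ hψ.1 hψ.2 K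
      (hD9M F ι₁ μ hμ hw ℓ ι' Jstar t ht hτt hτt' gstar dJ hdJ hdJ0 hg hsig K₀ S hU7ₛ hLQ h4 isoₛ r ε hadm χ hJ hJu K)

/-- **THE HEAD, SPLIT FORM (REF1 (g11) m03's expected shape)**: the REGISTERED `thmD6OneCurveCUF` from S1 (1), S1 (2), S2′, [D.9 on M⋆] (FACT, over the
untwisted datum `CM`∕`XM`), K2 (`stub_K2` over the same datum), and the ★-chain S4. -/
theorem thmD6OneCurveCUF_M_of_D9M_K2 (h1a : S1Shape) (h1b : S1bShape) (h2 : S2primeShape)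
    (hD9M : CorD9OnMShape CM XM) (hK2 : K2Shape CM XM) (h4 : S4ShapeA) : thmD6OneCurveCUF :=
  thmD6OneCurveCUF_M_of_facts_v9 h1a h1b h2 (s3ShapeM_of_D9M_K2 CM XM hD9M hK2) h4

end SplitK2

end Summit.HodgeConjecture.CorCM.Lines.A3Liu418


/-! ## Part K″ — [D.9 on M⋆] OPERATOR-LEVEL (A-plan2 (g12) 00:43:31Z «v17-D9op»): `CorD9OnMOp CM XM` = print's l. 5579–5585 on `ℚ̄_ℓ ⊗ H¹_ét(M⋆)`
itself (label-free, carrier-free, 14 binders), and the DERIVED g-form `corD9OnMShape_of_op : CorD9OnMOp → CorD9OnMShape` through the semilinear Hecke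
intertwiner (★ `heckeOperator` is the same coset sum for every representation). -/

namespace Summit.HodgeConjecture.CorCM.Lines.A3Liu418


/-- **A semilinear intertwiner carries `[KtK]` on `ω` to `[KtK] ⊗ 1`**: if `g : W →ₛₗ[τ] A ⊗ H` satisfies
`g (ω h w) = (ρ h ⊗ 1)(g w)` for all `h`, then `g ([KtK]_ω x) = ([KtK]_ρ ⊗ 1)(g x)` for every `x` (the coset representatives of
★ `heckeOperator` do not depend on the representation; `KtK/K` finite). [folklore] [cite: CartierCorvallis1979, §IV.1] -/
theorem heckeOperator_apply_semilinear_baseChange {kW kH A G W H : Type*} [CommRing kW] [CommRing kH] [CommRing A]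
    [Algebra kH A] [Group G] [AddCommGroup W] [Module kW W] [AddCommGroup H] [Module kH H] {τ : kW →+* A}
    (ω : Representation kW G W) (ρ : Representation kH G H) (K : Subgroup G) (t : G)
    (hfin : (MulAction.orbit K (t : G ⧸ K)).Finite)
    (g : W →ₛₗ[τ] A ⊗[kH] H) (hg : ∀ (h : G) (w : W), g (ω h w) = (ρ h).baseChange A (g w)) (x : W) :
    g (heckeOperator ω K t x) = (heckeOperator ρ K t).baseChange A (g x) := by
  classical
  have hbc : (∑ y ∈ hfin.toFinset, ρ y.out).baseChange A = ∑ y ∈ hfin.toFinset, (ρ y.out).baseChange A := by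
    simpa only [LinearMap.baseChangeHom_apply] using map_sum (LinearMap.baseChangeHom kH A H H) (fun y => ρ y.out) hfin.toFinset
  rw [heckeOperator, heckeOperator, finsum_mem_eq_finite_toFinset_sum _ hfin, finsum_mem_eq_finite_toFinset_sum _ hfin,
    LinearMap.sum_apply, map_sum, hbc, LinearMap.sum_apply]
  exact Finset.sum_congr rfl fun y _ => hg _ _

/-- The same for the spherical operators `heckeTAt` of the unitary group at a split place (`heckeTAt = heckeOperator` of
`heckeElementAt`, which does not depend on the representation). [cite: CartierCorvallis1979, §IV.1] -/
theorem heckeTAt_apply_semilinear_baseChange {F E : Type} [Field F] [NumberField F] [Field E] [NumberField E] [Algebra F E]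
    [Algebra.IsQuadraticExtension F E]
    (c : E ≃ₐ[F] E) (N : ℕ) (J : Matrix (Fin N) (Fin N) E)
    {kW kH A W H : Type*} [CommRing kW] [CommRing kH] [CommRing A] [Algebra kH A]
    [AddCommGroup W] [Module kW W] [AddCommGroup H] [Module kH H] {τ : kW →+* A}
    (ω : Representation kW (finAdelic F E c N J) W) (ρ : Representation kH (finAdelic F E c N J) H)
    (K : Subgroup (finAdelic F E c N J)) {v : HeightOneSpectrum (𝓞 F)} (w : PlacesOver E v) (hc : c ≠ 1)
    (hJ : (J.map c)ᵀ = J) (hw : c • w.1 ≠ w.1) (hJw : IsUnit (placeForm J w.1)) (ϖ : (w.1.adicCompletion E)ˣ) (i : ℕ)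
    (hfin : (MulAction.orbit K (heckeElementAt F E c N J w hc hJ hw hJw ϖ i : finAdelic F E c N J ⧸ K)).Finite)
    (g : W →ₛₗ[τ] A ⊗[kH] H) (hg : ∀ (h : finAdelic F E c N J) (x : W), g (ω h x) = (ρ h).baseChange A (g x)) (x : W) :
    g (UnitaryGroup.heckeTAt F E c N J ω K w hc hJ hw hJw ϖ i x) = (UnitaryGroup.heckeTAt F E c N J ρ K w hc hJ hw hJw ϖ i).baseChange A (g x) := by
  rw [UnitaryGroup.heckeTAt_def, UnitaryGroup.heckeTAt_def]
  exact heckeOperator_apply_semilinear_baseChange ω ρ K _ hfin g hg x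

/-- `KtK/K` is finite for a compact open `K` of the unitary group (★ `isHeckeTriple_top_of_isCompact_isOpen` + ★ `finite_orbit_quotient`).
[cite: CartierCorvallis1979, §I.3] -/
theorem finite_orbit_of_isCompact_isOpen {F E : Type} [Field F] [NumberField F] [Field E] [NumberField E] [Algebra F E]
    [Algebra.IsQuadraticExtension F E]
    (c : E ≃ₐ[F] E) (N : ℕ) (J : Matrix (Fin N) (Fin N) E) (K : Subgroup (finAdelic F E c N J))
    (hKc : IsCompact (K : Set (finAdelic F E c N J))) (hKo : IsOpen (K : Set (finAdelic F E c N J))) (t : finAdelic F E c N J) :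
    (MulAction.orbit K (t : finAdelic F E c N J ⧸ K)).Finite :=
  haveI := isHeckeTriple_top_of_isCompact_isOpen K hKc hKo
  finite_orbit_quotient K t


section OpK2

variable (CM : ∀ (F : Type) [Field F] [NumberField F] [IsCMField F] (ι₁ : F →+* ℂ) (Jstar : Matrix (Fin 2) (Fin 2) F)
      (K₀ : C5.OpenCompactSubgroup ↥(finAdelic ↥(maximalRealSubfield F) F (IsCMField.complexConj F) 2 Jstar))
      (S : RecordSystemGS F Jstar ι₁ K₀) (h4 : 4 ≤ Module.finrank ℚ F) (isoₛ : ℕ → Prop),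
      Sec42Data (Literature.NumberTheory.Automorphic.Liu2021.AppendixC.honestP5GSM F Jstar K₀ S.M) isoₛ)
  (XM : ∀ (F : Type) [Field F] [NumberField F] [IsCMField F] (ι₁ : F →+* ℂ) (Jstar : Matrix (Fin 2) (Fin 2) F)
      (K₀ : C5.OpenCompactSubgroup ↥(finAdelic ↥(maximalRealSubfield F) F (IsCMField.complexConj F) 2 Jstar))
      (S : RecordSystemGS F Jstar ι₁ K₀) (hU7ₛ : S.HeckeTranslateDefinedOver) (hLQ : S.IsLevelQuotient)
      (h4 : 4 ≤ Module.finrank ℚ F) (isoₛ : ℕ → Prop) (ℓ : ℕ) [Fact ℓ.Prime],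
      (CM F ι₁ Jstar K₀ S h4 isoₛ).EtaleHeckeDatum ℓ)

/-- **`CorD9OnMOp CM XM` — [Liu2021, Cor. D.9] (l. 5579–5585) for the untwisted tower `M⋆`, OPERATOR-LEVEL on `ℚ̄_ℓ ⊗ H¹_ét(A(M⋆)_∞)`**:
for every sufficiently small level `K`, off finitely many places, at every place `w` of `F` split over `w⁺` with `J⋆_w ∈ GL₂(𝒪_w)` and `K`
hyperspecial at `w⁺`, every ARITHMETIC Frobenius `σ` at `𝔓 ∣ w` satisfies `N(w) • Φ_σ² ∘ T_{w,2} − Φ_σ ∘ T_{w,1} + 1 = 0` on the `K`-fixed classes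
(`Φ_σ := towerRep ⊗ 1`, `T_{w,i} := heckeTAt rhoEt ⊗ 1` at the standard anchor `⟨w, rfl⟩`; print's «`X² − t_ϖ^* X + q⟨ϖ⟩^* = 0` for the geometric
Frobenius» divided by `Φ⁻²`).  The FACT kind of s201 (3)(i), text for REF1's ≤-print checklist. -/
def CorD9OnMOp : Prop :=
  ∀ F [Field F] [NumberField F] [IsCMField F] [IsGalois ℚ F] (ι₁ : F →+* ℂ) (ℓ : ℕ) [Fact ℓ.Prime]
    (Jstar : Matrix (Fin 2) (Fin 2) F)
    (K₀ : C5.OpenCompactSubgroup ↥(finAdelic ↥(maximalRealSubfield F) F (IsCMField.complexConj F) 2 Jstar))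
    (S : RecordSystemGS F Jstar ι₁ K₀) (hU7ₛ : S.HeckeTranslateDefinedOver) (hLQ : S.IsLevelQuotient)
    (h4 : 4 ≤ Module.finrank ℚ F) (isoₛ : ℕ → Prop)
    (hJ : (Jstar.map (IsCMField.complexConj F))ᵀ = Jstar) (hJu : IsUnit Jstar) (K : C5.SmallLevel K₀),
    ∃ S₀ : Set (HeightOneSpectrum (𝓞 F)), S₀.Finite ∧
      ∀ w : HeightOneSpectrum (𝓞 F), w ∉ S₀ → ∀ hw : (IsCMField.complexConj F) • w ≠ w,
        (UnitaryGroup.isUnit_placeForm Jstar hJu w).unit ∈ glInt 2 (w.adicCompletion F) →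
            UnitaryGroup.IsHyperspecialAt ↥(maximalRealSubfield F) F (IsCMField.complexConj F) 2 Jstar K.1.1 (w.under (𝓞 ↥(maximalRealSubfield F))) →
            ∀ 𝔓 ∈ w.primesAbove, ∀ σ : Field.absoluteGaloisGroup F, IsArithFrobAt (𝓞 F) σ 𝔓 →
            ∀ y : AlgebraicClosure ℚ_[ℓ] ⊗[ℚ_[ℓ]] (CM F ι₁ Jstar K₀ S h4 isoₛ).etaleH1Tower ℓ,
              (∀ k ∈ K.1.1, ((XM F ι₁ Jstar K₀ S hU7ₛ hLQ h4 isoₛ ℓ).rhoEt k).baseChange (AlgebraicClosure ℚ_[ℓ]) y = y) →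
              (Ideal.absNorm w.asIdeal : AlgebraicClosure ℚ_[ℓ]) •
                  ((CM F ι₁ Jstar K₀ S h4 isoₛ).towerRep ℓ σ).baseChange (AlgebraicClosure ℚ_[ℓ])
                    (((CM F ι₁ Jstar K₀ S h4 isoₛ).towerRep ℓ σ).baseChange (AlgebraicClosure ℚ_[ℓ])
                      ((UnitaryGroup.heckeTAt ↥(maximalRealSubfield F) F (IsCMField.complexConj F) 2 Jstar
                  (XM F ι₁ Jstar K₀ S hU7ₛ hLQ h4 isoₛ ℓ).rhoEt K.1.1
                  (⟨w, rfl⟩ : UnitaryGroup.PlacesOver F (w.under (𝓞 ↥(maximalRealSubfield F))))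
                  (IsCMField.complexConj_ne_one F) hJ hw (UnitaryGroup.isUnit_placeForm Jstar hJu w) (HeckeCharacter.uniformizer F w) 2).baseChange
                  (AlgebraicClosure ℚ_[ℓ]) y)) -
                ((CM F ι₁ Jstar K₀ S h4 isoₛ).towerRep ℓ σ).baseChange (AlgebraicClosure ℚ_[ℓ])
                  ((UnitaryGroup.heckeTAt ↥(maximalRealSubfield F) F (IsCMField.complexConj F) 2 Jstar
                  (XM F ι₁ Jstar K₀ S hU7ₛ hLQ h4 isoₛ ℓ).rhoEt K.1.1
                  (⟨w, rfl⟩ : UnitaryGroup.PlacesOver F (w.under (𝓞 ↥(maximalRealSubfield F))))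
                  (IsCMField.complexConj_ne_one F) hJ hw (UnitaryGroup.isUnit_placeForm Jstar hJu w) (HeckeCharacter.uniformizer F w) 1).baseChange
                  (AlgebraicClosure ℚ_[ℓ]) y) +
                y = 0

/-- **[D.9 on M⋆] operator-level ⇒ the g-form `CorD9OnMShape`** (default budget: `Exists.elim` instead of `obtain`, A-p06 (g15) fix 3): for `g ∈ Hom(ι′ ∘ ω⋆, ℚ̄_ℓ ⊗ H¹(M⋆))` and `x ∈ ω⋆^K`, `g x` is
`K`-fixed and `g (T_{w,i}^ω x) = (T_{w,i} ⊗ 1)(g x)` (`heckeTAt_apply_semilinear_baseChange`; `KtK/K` finite for the compact open `K`). -/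
theorem corD9OnMShape_of_op (hop : CorD9OnMOp CM XM) : CorD9OnMShape CM XM := by
  intro F _ ι₁ μ hμ hw ℓ _ ι' Jstar t ht hτt hτt' gstar dJ hdJ hdJ0 hg hsig K₀ S hU7ₛ hLQ h4 isoₛ r ε hadm χ hJ hJu K
  refine (hop (F : Type) ι₁ ℓ Jstar K₀ S hU7ₛ hLQ h4 isoₛ hJ hJu K).elim fun S₀ hS => ⟨S₀, hS.1, ?_⟩
  have h := hS.2
  intro w hwS hw hJi hK 𝔓 h𝔓 σ hσ g hgH x hx
  have hgω := (Sec42Data.EtaleHeckeDatum.mem_omegaHom_iff _ _ _ _).1 hgH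
  -- `g x` is `K`-fixed for `rhoEt ⊗ 1`
  have hy : ∀ k ∈ K.1.1, ((XM (F : Type) ι₁ Jstar K₀ S hU7ₛ hLQ h4 isoₛ ℓ).rhoEt k).baseChange (AlgebraicClosure ℚ_[ℓ]) (g x) = g x :=
    fun k hk => (hgω k x).symm.trans (congrArg g ((Representation.mem_fixedPoints _ _ _).1 hx k hk))
  have rel := h w hwS hw hJi hK 𝔓 h𝔓 σ hσ (g x) hy
  -- `g ∘ T^ω = (T ⊗ 1) ∘ g` at the two operators (finite coset sums, representation-independent)
  have e : ∀ i : ℕ,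
      (UnitaryGroup.heckeTAt ↥(maximalRealSubfield (F : Type)) (F : Type) (IsCMField.complexConj (F : Type)) 2 Jstar
                  (XM (F : Type) ι₁ Jstar K₀ S hU7ₛ hLQ h4 isoₛ ℓ).rhoEt K.1.1
                  (⟨w, rfl⟩ : UnitaryGroup.PlacesOver (F : Type) (w.under (𝓞 ↥(maximalRealSubfield (F : Type)))))
                  (IsCMField.complexConj_ne_one (F : Type)) hJ hw (UnitaryGroup.isUnit_placeForm Jstar hJu w) (HeckeCharacter.uniformizer (F : Type) w) i).baseChange
                  (AlgebraicClosure ℚ_[ℓ]) (g x) =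
      g (UnitaryGroup.heckeTAt ↥(maximalRealSubfield (F : Type)) (F : Type) (IsCMField.complexConj (F : Type)) 2 Jstar _ K.1.1
            (⟨w, rfl⟩ : UnitaryGroup.PlacesOver (F : Type) (w.under (𝓞 ↥(maximalRealSubfield (F : Type)))))
            (IsCMField.complexConj_ne_one (F : Type)) hJ hw (UnitaryGroup.isUnit_placeForm Jstar hJu w) (HeckeCharacter.uniformizer (F : Type) w) i x) :=
    fun i => (heckeTAt_apply_semilinear_baseChange (IsCMField.complexConj (F : Type)) 2 Jstar
      ((rhoVAtLine ↥(maximalRealSubfield (F : Type)) (F : Type) (IsCMField.complexConj (F : Type)) 2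
          (finProdFinEquiv : Fin 2 × Fin 1 ≃ Fin (2 * 1)) (Matrix.diagonal dJ)
          (complexConj_imagUnit F) (imagUnit_ne_zero F) (imagUnit_mul_self F) (realDiagonal_isSymm F dJ hdJ)
          (isUnit_det_realDiagonal F dJ hdJ hdJ0) (realDiagonal_map F dJ hdJ).symm
          (hsChiGS F finProdFinEquiv dJ hdJ hdJ0
            (toHeckeCharacter (F : Type) (galConj (IsCMField.complexConj (F : Type)) μ))
            (isUnitary_toHeckeCharacter (F : Type) (galConj (IsCMField.complexConj (F : Type)) μ))
            ((isOscillatorChar_toHeckeCharacter_iff (galConj (IsCMField.complexConj (F : Type)) μ)).mpr hμ.galConj))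
          (r.toFun ε) χ).comp
          (finAdelicCongr ↥(maximalRealSubfield (F : Type)) (F : Type) (IsCMField.complexConj (F : Type)) gstar ht hg).symm.toMonoidHom)
      (XM (F : Type) ι₁ Jstar K₀ S hU7ₛ hLQ h4 isoₛ ℓ).rhoEt K.1.1
      (⟨w, rfl⟩ : UnitaryGroup.PlacesOver (F : Type) (w.under (𝓞 ↥(maximalRealSubfield (F : Type)))))
      (IsCMField.complexConj_ne_one (F : Type)) hJ hw (UnitaryGroup.isUnit_placeForm Jstar hJu w) (HeckeCharacter.uniformizer (F : Type) w) i
      (finite_orbit_of_isCompact_isOpen (IsCMField.complexConj (F : Type)) 2 Jstar K.1.1 K.1.2.2 K.1.2.1 _) g hgω x).symm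
  have key : ∀ y₂ y₁ : AlgebraicClosure ℚ_[ℓ] ⊗[ℚ_[ℓ]] (CM (F : Type) ι₁ Jstar K₀ S h4 isoₛ).etaleH1Tower ℓ,
      (UnitaryGroup.heckeTAt ↥(maximalRealSubfield (F : Type)) (F : Type) (IsCMField.complexConj (F : Type)) 2 Jstar
                  (XM (F : Type) ι₁ Jstar K₀ S hU7ₛ hLQ h4 isoₛ ℓ).rhoEt K.1.1
                  (⟨w, rfl⟩ : UnitaryGroup.PlacesOver (F : Type) (w.under (𝓞 ↥(maximalRealSubfield (F : Type)))))
                  (IsCMField.complexConj_ne_one (F : Type)) hJ hw (UnitaryGroup.isUnit_placeForm Jstar hJu w) (HeckeCharacter.uniformizer (F : Type) w) 2).baseChange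
                  (AlgebraicClosure ℚ_[ℓ]) (g x) = y₂ →
      (UnitaryGroup.heckeTAt ↥(maximalRealSubfield (F : Type)) (F : Type) (IsCMField.complexConj (F : Type)) 2 Jstar
                  (XM (F : Type) ι₁ Jstar K₀ S hU7ₛ hLQ h4 isoₛ ℓ).rhoEt K.1.1
                  (⟨w, rfl⟩ : UnitaryGroup.PlacesOver (F : Type) (w.under (𝓞 ↥(maximalRealSubfield (F : Type)))))
                  (IsCMField.complexConj_ne_one (F : Type)) hJ hw (UnitaryGroup.isUnit_placeForm Jstar hJu w) (HeckeCharacter.uniformizer (F : Type) w) 1).baseChange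
                  (AlgebraicClosure ℚ_[ℓ]) (g x) = y₁ →
      (Ideal.absNorm w.asIdeal : AlgebraicClosure ℚ_[ℓ]) •
          ((CM (F : Type) ι₁ Jstar K₀ S h4 isoₛ).towerRep ℓ σ).baseChange (AlgebraicClosure ℚ_[ℓ])
            (((CM (F : Type) ι₁ Jstar K₀ S h4 isoₛ).towerRep ℓ σ).baseChange (AlgebraicClosure ℚ_[ℓ]) y₂) -
        ((CM (F : Type) ι₁ Jstar K₀ S h4 isoₛ).towerRep ℓ σ).baseChange (AlgebraicClosure ℚ_[ℓ]) y₁ + g x = 0 := by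
    rintro _ _ rfl rfl
    exact rel
  exact key _ _ (e 2) (e 1)

/-- **THE HEAD, OPERATOR-LEVEL FACT + SPLIT K2 (v17)**: the REGISTERED `thmD6OneCurveCUF` from S1 (1), S1 (2), S2′, [D.9 on M⋆] OPERATOR-LEVEL,
`stub_K2`, and the ★-chain S4. -/
theorem thmD6OneCurveCUF_M_of_D9Mop_K2 (h1a : S1Shape) (h1b : S1bShape) (h2 : S2primeShape)
    (hD9op : CorD9OnMOp CM XM) (hK2 : K2Shape CM XM) (h4 : S4ShapeA) : thmD6OneCurveCUF :=
  thmD6OneCurveCUF_M_of_D9M_K2 CM XM h1a h1b h2 (corD9OnMShape_of_op CM XM hD9op) hK2 h4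

end OpK2

end Summit.HodgeConjecture.CorCM.Lines.A3Liu418


/-! ## Part M («v21-byimport») — §JUNCTION BY IMPORT: ★ `Summits.HodgeConjecture.CorCM.HypLiu418.A3Liu418GSConjugateTransport` (p756780, Part B;
Part A `A3Liu418GSUntwisted` p756410) supplies `k2_towerEquiv`; ★ `Literature.…Liu2021.LemD1SplitPlaceHeckeEigenvaluesChain` (p756442) supplies the
[Lem. D.1(1)] chain at the `galConj c μ^{alg}`-splitting carrier. `CMgsm`/`XMgsm` := the LITERATURE `sec42DataGSM`/`etaleHeckeDatumGSM` (A-p12 (g9) (P) body,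
Part K⁰ paste — the filing shape of the schema instance); `k2Shape_holds` re-packs the ★ Summits-side K2 transport at them (δ-equal data, A-p12 rflcheck
6de42925); `s4ShapeA_holds` = one application of the ★ chain; HEAD `thmD6OneCurveCUF_of_D9Mop` with FOUR hypotheses: the three Summits stubs and the
Literature FACT `CorD9OnMOp CMgsm XMgsm`. -/

namespace Summit.HodgeConjecture.CorCM.Lines.A3Liu418

section Junction

/-- The d6 line's `CM`: the LITERATURE §4.2 datum of the untwisted record curve `M⋆`, as a family over unbundled CM fields. -/
abbrev CMgsm : ∀ (F : Type) [Field F] [NumberField F] [IsCMField F] (ι₁ : F →+* ℂ) (Jstar : Matrix (Fin 2) (Fin 2) F)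
    (K₀ : C5.OpenCompactSubgroup ↥(finAdelic ↥(maximalRealSubfield F) F (IsCMField.complexConj F) 2 Jstar))
    (S : RecordSystemGS F Jstar ι₁ K₀) (_h4 : 4 ≤ Module.finrank ℚ F) (isoₛ : ℕ → Prop),
    Sec42Data (Literature.NumberTheory.Automorphic.Liu2021.AppendixC.honestP5GSM F Jstar K₀ S.M) isoₛ :=
  fun _F _ _ _ _ι₁ _Jstar _K₀ S h4 isoₛ => Literature.NumberTheory.Automorphic.Liu2021.AppendixC.sec42DataGSM S h4 isoₛ

/-- The d6 line's `XM`: the LITERATURE étale Hecke datum of `M⋆` (Hecke translates from u1, level-quotient from u4). -/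
abbrev XMgsm : ∀ (F : Type) [Field F] [NumberField F] [IsCMField F] (ι₁ : F →+* ℂ) (Jstar : Matrix (Fin 2) (Fin 2) F)
    (K₀ : C5.OpenCompactSubgroup ↥(finAdelic ↥(maximalRealSubfield F) F (IsCMField.complexConj F) 2 Jstar))
    (S : RecordSystemGS F Jstar ι₁ K₀) (hU7ₛ : S.HeckeTranslateDefinedOver) (hLQ : S.IsLevelQuotient)
    (h4 : 4 ≤ Module.finrank ℚ F) (isoₛ : ℕ → Prop) (ℓ : ℕ) [Fact ℓ.Prime],
    (CMgsm F ι₁ Jstar K₀ S h4 isoₛ).EtaleHeckeDatum ℓ :=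
  fun _F _ _ _ _ι₁ _Jstar _K₀ S hU7ₛ hLQ h4 isoₛ ℓ _ =>
    Literature.NumberTheory.Automorphic.Liu2021.AppendixC.etaleHeckeDatumGSM S hU7ₛ hLQ h4 isoₛ ℓ

/-- **`stub_K2` DISCHARGED** by the ★ theorem `k2_towerEquiv`: the K2 transport `(ψ, K2b, K2c)` for `(CMgsm, XMgsm)`. -/
theorem k2Shape_holds : K2Shape CMgsm XMgsm := by
  intro F _ ι₁ ℓ _ Jstar K₀ S hU7ₛ hLQ h4 isoₛ
  obtain ⟨Ψ, hH, hF⟩ := k2_towerEquiv (S := S) h4 isoₛ hU7ₛ hLQ ℓ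
  exact ⟨Ψ, hH, fun w _ 𝔓 h𝔓 σ hσ => hF w 𝔓 h𝔓 σ hσ⟩

/-- **`S4ShapeA` DISCHARGED** by the ★ theorem `lemD1_splitPlace_heckeEigenvalues_galConjCarrier` ([Liu2021, Lem. D.1(1)] chain, reading (A)). -/
theorem s4ShapeA_holds : S4ShapeA := by
  intro F _ ι₁ μ hμ hw ℓ _ ι' Jstar t ht hτt hτt' gstar dJ hdJ hdJ0 hg hsig K₀ S hU7ₛ hLQ h4 isoₛ r ε hadm χ hJ hJu
  exact Literature.NumberTheory.Automorphic.Liu2021.Def411WeilCarriers.lemD1_splitPlace_heckeEigenvalues_galConjCarrier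
    (F : Type) μ hμ Jstar t ht gstar dJ hdJ hdJ0 hg r ε χ hJ hJu

/-- **HEAD of the d6 line («v21-byimport»)**: the REGISTERED `thmD6OneCurveCUF` from the three Summits stubs `S1Shape`/`S1bShape`/`S2primeShape`
and the Literature FACT `CorD9OnMOp CMgsm XMgsm` ([Liu2021, Cor. D.9] on `M⋆`, operator form); `stub_K2` and `S4ShapeA` discharged by ★ theorems. -/
theorem thmD6OneCurveCUF_of_D9Mop (h1a : S1Shape) (h1b : S1bShape) (h2 : S2primeShape)
    (hD9op : CorD9OnMOp CMgsm XMgsm) : thmD6OneCurveCUF :=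
  thmD6OneCurveCUF_M_of_D9Mop_K2 CMgsm XMgsm h1a h1b h2 hD9op k2Shape_holds s4ShapeA_holds

end Junction

end Summit.HodgeConjecture.CorCM.Lines.A3Liu418

end

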